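import Literature.Computability.Cryptography.VDSCopyBlocks
import Literature.Computability.Cryptography.VDSCopyCircuit
import Literature.Computability.QuantumComplexity.SandwichBlock
import HarnessLib

/-!
# The van Dam–Seroussi copy, IV: primitives of the symbolic execution

Topic `Literature/Computability/Cryptography`; sequel of `VDSCopyBlocks.lean` and `VDSCopyCircuit.lean`
for the discharge of `VanDamSeroussi2002_gaussSumPhase_qsolvable`. The state of the copy is tracked as a
finite superposition of labels `lab P cfg` of register contents; this file provides the rules moving
such labels through the gate-level primitives of the copy:

* `xgates_mulVec_basisState` — an oracle XOR block acts on a basis label by `OracleXor.run`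
  (`toMatrix_oracles_mulVec_basisState`), hence by the write/erase rules of `VDSCopyBlocks.lean`;
* `writeB_reg_lab`, `writeNat_reg_lab` — writing a bit vector / a number on a register (the forms
  used by `KitaevEmb.block_mulVec_superposition` and `KitaevShift.mode_factorisation`) updates the
  contents;
* `sum_boolVec_eq_sum_range` — re-indexing a sum over bit vectors by their values;
* **`hLayer_reg_lab`** — Hadamard on a clean register: `|lab cfg⟩ ↦ 2^{-w/2} Σ_{v<2^w} |lab cfg[r ↦ v]⟩`
  (Nielsen–Chuang 2010, eq. (1.50), via `KitaevEmb.hLayer_mulVec_basisState`).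

Everything is proved; no named fact.

## References

* M. A. Nielsen, I. L. Chuang, CUP 2010, §1.4.4 eq. (1.50), §4.1 [NielsenChuang2010].
* C. H. Bennett, E. Bernstein, G. Brassard, U. Vazirani, SIAM J. Comput. 26 (1997), Cor. 4.15 [BennettBernsteinBrassardVazirani1997].
-/

noncomputable section

namespace Literature.Computability.Cryptography

namespace VDSCopy

open _root_.Computability Complexity QuantumComplexity QuantumComplexity.SegLayout QuantumComplexity.QFTQubits VDSOracle Kitaev1995
open Matrix Finset

variable (P : Prm)

/-! ### Oracle blocks on basis labels -/

/-- **An oracle XOR block acts on a basis label classically.** [cite: BennettBernsteinBrassardVazirani1997, Cor. 4.15] -/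
theorem xgates_mulVec_basisState (A : Language Bool) (k : ℕ) (z : QReg (bw P)) :
    (⟨xgates P k⟩ : QCircuit cliffordT (bw P)).toMatrix A *ᵥ basisState z = basisState (OracleXor.run A (xblock P k).gates z) :=
  OracleXor.toMatrix_oracles_mulVec_basisState A (xblock P k).gates z

/-- An oracle XOR block on a finite superposition of basis labels. [folklore] -/
theorem xgates_mulVec_sum {ι : Type*} (A : Language Bool) (k : ℕ) (s : Finset ι) (c : ι → ℂ) (z : ι → QReg (bw P)) :
    (⟨xgates P k⟩ : QCircuit cliffordT (bw P)).toMatrix A *ᵥ (∑ i ∈ s, c i • basisState (z i)) =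
      ∑ i ∈ s, c i • basisState (OracleXor.run A (xblock P k).gates (z i)) := by
  rw [Matrix.mulVec_sum]
  refine sum_congr rfl fun i _ => ?_
  rw [Matrix.mulVec_smul, xgates_mulVec_basisState]

/-! ### Writing on a register of a label -/

/-- **Writing a bit vector on register `r`** updates the contents by its value. [folklore] -/
theorem writeB_reg_lab (cfg : ℕ → ℕ) (r : R) (y : Fin (wd P r) → Bool) :
    writeB (reg P r) (lab P cfg) y = lab P (Function.update cfg r.idx (bitsToNat (List.ofFn y))) := by
  have e : y = fun i : Fin (wd P r) => (bitsToNat (List.ofFn y)).testBit i := by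
    funext i
    rw [Complexity.testBit_bitsToNat_eq_getD, List.getD_eq_getElem?_getD, List.getElem?_ofFn]
    simp
  conv_lhs => rw [e]
  rw [writeB_reg, lab, writeB_emb_lay]
  rfl

/-- **Writing a number on the wires of register `r`** (`SandwichBlock.writeNat`) updates the contents. [folklore] -/
theorem writeNat_reg_lab (cfg : ℕ → ℕ) (r : R) (v : ℕ) :
    writeNat (List.ofFn (reg P r)) (lab P cfg) v = lab P (Function.update cfg r.idx v) := by
  have hnd : (List.ofFn (reg P r)).Nodup := List.nodup_ofFn.2 (reg P r).injective
  have hw : writeNat (List.ofFn (reg P r)) (lab P cfg) v = writeB (reg P r) (lab P cfg) (fun i => v.testBit i) := by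
    refine (KitaevEmb.eq_writeB_iff (reg P r) (lab P cfg) _ _).2 ⟨fun w hw => ?_, funext fun i => ?_⟩
    · exact writeNat_apply_of_not_mem _ _ _ (fun hm => hw (by obtain ⟨i, hi⟩ := List.mem_ofFn.1 hm; exact ⟨i, hi⟩))
    · have h := writeNat_getElem (List.ofFn (reg P r)) hnd (lab P cfg) v i (by simp)
      simp only [List.getElem_ofFn] at h
      exact h
  rw [hw, writeB_reg, lab, writeB_emb_lay]
  rfl

/-! ### Sums over bit vectors -/

/-- **Re-indexing a sum over bit vectors of length `w` by their values `< 2^w`.** [folklore] -/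
theorem sum_boolVec_eq_sum_range {M : Type*} [AddCommMonoid M] (w : ℕ) (F : ℕ → M) :
    ∑ y : Fin w → Bool, F (bitsToNat (List.ofFn y)) = ∑ v ∈ range (2 ^ w), F v := by
  refine sum_nbij' (fun y => bitsToNat (List.ofFn y)) (fun v i => v.testBit i) (fun y _ => ?_) (fun v _ => mem_univ _)
    (fun y _ => ?_) (fun v hv => ?_) (fun y _ => rfl)
  · rw [mem_range]
    have := bitsToNat_lt (List.ofFn y)
    simpa using this
  · funext i
    rw [Complexity.testBit_bitsToNat_eq_getD, List.getD_eq_getElem?_getD, List.getElem?_ofFn]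
    simp
  · show bitsToNat (List.ofFn fun i : Fin w => v.testBit i) = v
    exact bitsToNat_bits_of_lt (mem_range.1 hv)

/-! ### Hadamard layers on a clean register -/

/-- The sign against a clean register is `1`. [folklore] -/
theorem ySign_zero {k : ℕ} (y : Fin k → Bool) : ySign (fun _ => false) y = 1 := by
  rw [ySign]; exact prod_eq_one fun j _ => by simp

/-- **Hadamard on a clean register**: `|lab cfg⟩ ↦ 2^{-w/2} Σ_{v < 2^w} |lab cfg[r ↦ v]⟩`.
[cite: NielsenChuang2010, §1.4.4 eq. (1.50)] -/
theorem hLayer_reg_lab (A : Language Bool) (cfg : ℕ → ℕ) (r : R) (h0 : cfg r.idx = 0) :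
    (⟨KitaevEmb.hLayer (reg P r)⟩ : QCircuit cliffordT (bw P)).toMatrix A *ᵥ basisState (lab P cfg) =
      invSqrt2 ^ wd P r • ∑ v ∈ range (2 ^ wd P r), basisState (lab P (Function.update cfg r.idx v)) := by
  have hA : (⟨KitaevEmb.hLayer (reg P r)⟩ : QCircuit cliffordT (bw P)).toMatrix A = (⟨KitaevEmb.hLayer (reg P r)⟩ : QCircuit cliffordT (bw P)).toMatrix 0 :=
    QCircuit.toMatrix_eq_of_isOracleFree (KitaevEmb.hLayer_isOracleFree _) A 0
  rw [hA, KitaevEmb.hLayer_mulVec_basisState]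
  have hclean : lab P cfg ∘ reg P r = fun _ => false := by
    funext i; show lab P cfg (reg P r i) = false; rw [lab_reg, h0, Nat.zero_testBit]
  simp_rw [hclean, ySign_zero, one_smul, writeB_reg_lab]
  rw [sum_boolVec_eq_sum_range (wd P r) (fun v => basisState (lab P (Function.update cfg r.idx v)))]

end VDSCopy

end Literature.Computability.Cryptography

end
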